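import Summits.QuantumFields.BalabanUV.T4Continuum.Support.VariationalCovariantScalarPair

/-!
# T⁴ programme, spine node NE2 (U1a), lane P2 — THE TIER-⁺ ASSEMBLY WITH LEAF ONE⁺ IN ITS HONEST COVARIANT SHAPE
# `T_{Q₁}Sf (f) ≤ (√(Sc f + ε₁·ρ f) + δ′·√(qW f))²` (the one-step transport defect enters linearly inside the square, as in FED⁺)

NE2 formalisation swarm `b2b-balaban-t4-ne2-formalise-*`, leaf 01 GEN 2 (`prover-b2b-balaban-t4-ne2-formalise-leaf-01-g2-0`), SUPPLIER SEAT for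
leaf ONE⁺ («s5») of the P2 (variational) skeleton `t4/skeletons/NE2-t4-ne2-p2.md` v0.6 §2.C ∕ §3; journal CLAIM CLAIMS.log l.8374, RESULT l.8788.
This file is a VARIANT of the road owner's `VariationalCovariantAssembly.pair_bracket` (p211487) and `VariationalCovariantScalarPair.
scalar_pair_bracket` (p211992), importing both BY NAME and changing ONE binder: the leaf ONE⁺ is taken in the shape that the explicit
covariant competitor actually delivers (`VariationalCovariantOneStepPhys.blockSpin_Q1_le`),

  `hONE′ : ∀ f, blockSpin Q₁ Sf f ≤ (√(Sc f + ε₁·ρ f) + δ′·√(qW f))²`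

instead of the purely additive `Sc f + ε₁ρ f + ε₂ qW f` (which holds for transport-FLAT one-step data only: `blockSpin_Q1_le_flat`).  WHY
(located before proving, journal l.8374; kernel fact l.8788): with a one-step transport mismatch `m > 0` the competitor's energy carries the
LINEAR cross term `2√(Sc + ε₁ρ)·δ′√qW` — first order in the field strength, the order the owner's numerics see (N-ne2p2g10-1:
`‖X_{k+1} − X_k‖ ≈ 82·L^{−2k} + 2.4·α·L^{−k}`) — and no additive bound with coefficient 1 on `Sc` absorbs it.  At the coarse minimiser
the owner's own `defect_bound` turns it into the additive defect
`e′ = ε₁C_R(Λ+1) + 2δ′√((Λ + ε₁C_R(Λ+1))·C_P(Λ+1)) + δ′²·C_P(Λ+1)` (`pair_bracket_sqrt`); the charged-scalar instantiation with FED⁺ and P⁺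
discharged inside is `scalar_pair_bracket_sqrt` (the letters of p211992).

HONEST FRAMING (T4-DAG p. 1).  Rung (B)+1 only — NOT infinite volume, NOT a mass gap, NOT Clay.  NE2 is NOT IN PRINT and NOT proved here;
this is route COMPOSITION at model level (transporters, frames = DATA; global small-field frame conditions as in the capstone); UB⁺, ONE⁺
(in the shape above), REG⁺ remain HYPOTHESES of this file (ONE⁺ is supplied by `VariationalCovariantOneStepPhys.blockSpin_Q1_le`, UB⁺ by
`VariationalCovariantUpperBound.exists_ub_scalarPair`; REG⁺ open); nothing printed is a hypothesis; no `def`; no `sorry`; axioms standard.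
HONEST DEPENDENCY (cell, verbatim): continuum YM on T⁴ ⇐ BetaPertH ∧ nine spine estimates (0/9 proved); BetaPertH ⇐ (D1) ∧ (D4) ∧ CAP+tail;
G-an2-4 gates asym, D1 and NE2/3/4.
-/

noncomputable section

namespace Summit.QuantumFields.BalabanUV.T4Continuum.VariationalCovariantAssemblySqrt

open Finset
open scoped ComplexConjugate
open Literature.MathematicalPhysics.QuantumFieldTheory.Balaban1983to89
open Literature.MathematicalPhysics.QuantumFieldTheory.Balaban1983to89.B5Prop11Plancherel (Tor fine unitVec)
open Literature.MathematicalPhysics.QuantumFieldTheory.Balaban1983to89.B5Prop11Lower (nsq nsq_nonneg)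
open Literature.MathematicalPhysics.QuantumFieldTheory.Balaban1983to89.B5Block118 (bpt)
open Summit.QuantumFields.BalabanUV.T4Continuum.VariationalTransfer (blockSpin)
open Summit.QuantumFields.BalabanUV.T4Continuum.VariationalAdditive (step_additive)
open Summit.QuantumFields.BalabanUV.T4Continuum.VariationalCovariantAssembly (exists_isMinOn_fib defect_bound)
open Summit.QuantumFields.BalabanUV.T4Continuum.VariationalCovariantFederbush (mis)
open Summit.QuantumFields.BalabanUV.T4Continuum.VariationalCovariantScalarPair
  (Sc Sf qW qV Qk Q1 Sc_nonneg Sf_nonneg qW_nonneg qV_nonneg norm_sq_le_qW norm_sq_le_qV continuous_Qc continuous_sum_dirU Q1_surjective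
   qW_le_coarse qV_le_composite Sc_Q1_le)

variable {d : ℕ}

/-! ## §1 The abstract bracket with ONE⁺ in the square-root shape -/

section Pair

variable {V W Z : Type*} [NormedAddCommGroup V] [ProperSpace V] [NormedAddCommGroup W] [ProperSpace W] [TopologicalSpace Z] [T1Space Z]

/-- **THE CANONICAL-PAIR ADDITIVE BRACKET WITH ONE⁺ IN ITS HONEST COVARIANT SHAPE**: as `VariationalCovariantAssembly.pair_bracket`, with the
binder `hONE′ : ∀ f, T_{Q₁}Sf (f) ≤ (√(Sc f + ε₁·ρ f) + δ′·√(qW f))²`; conclusions `Δ_k(μ) ≤ Δ_{k+1}(μ) + e·qZ μ` (unchanged,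
`e = 2δ√(Λ·C_P(Λ+1)) + δ²·C_P(Λ+1)`) and `Δ_{k+1}(μ) ≤ Δ_k(μ) + e′·qZ μ` with
`e′ = ε₁C_R(Λ+1) + 2δ′√((Λ + ε₁C_R(Λ+1))·C_P(Λ+1)) + δ′²·C_P(Λ+1)` (the owner's `defect_bound` at the coarse minimiser). [folklore] -/
theorem pair_bracket_sqrt
    {Qk : W → Z} {Q₁ : V → W} {Sc : W → ℝ} {Sf : V → ℝ} {qW : W → ℝ} {qV : V → ℝ} {qZ : Z → ℝ} {ρ : W → ℝ}
    (hQk : Continuous Qk) (hQ₁ : Continuous Q₁) (hSc : Continuous Sc) (hSf : Continuous Sf) (hsurj : Function.Surjective Q₁)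
    (hSc0 : ∀ f, 0 ≤ Sc f) (hSf0 : ∀ f', 0 ≤ Sf f') (hqV0 : ∀ f', 0 ≤ qV f') (hqW0 : ∀ f, 0 ≤ qW f) (hqZ0 : ∀ μ, 0 ≤ qZ μ)
    (hρ0 : ∀ f, 0 ≤ ρ f)
    {κ Λ CP CR δ ε₁ δ' : ℝ} (hκ : 0 ≤ κ) (hΛ : 0 ≤ Λ) (hCP : 0 ≤ CP) (hCR : 0 ≤ CR) (hδ : 0 ≤ δ) (hε₁ : 0 ≤ ε₁) (hδ' : 0 ≤ δ')
    (hnormW : ∀ f, ‖f‖ ^ 2 ≤ κ * qW f) (hnormV : ∀ f', ‖f'‖ ^ 2 ≤ κ * qV f')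
    -- leaf UB⁺ at both levels
    (hUBc : ∀ μ, ∃ f, Qk f = μ ∧ Sc f ≤ Λ * qZ μ) (hUBf : ∀ μ, ∃ f', Qk (Q₁ f') = μ ∧ Sf f' ≤ Λ * qZ μ)
    -- leaf P⁺ at both levels
    (hPc : ∀ f, qW f ≤ CP * (Sc f + qZ (Qk f))) (hPf : ∀ f', qV f' ≤ CP * (Sf f' + qZ (Qk (Q₁ f'))))
    -- leaf FED⁺ (additive covariant Federbush)
    (hFED : ∀ f', Sc (Q₁ f') ≤ (Real.sqrt (Sf f') + δ * Real.sqrt (qV f')) ^ 2)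
    -- leaf ONE⁺ in the honest covariant shape, and leaf REG⁺
    (hONE : ∀ f, blockSpin Q₁ Sf f ≤ (Real.sqrt (Sc f + ε₁ * ρ f) + δ' * Real.sqrt (qW f)) ^ 2)
    (hREG : ∀ μ f, Qk f = μ → (∀ g, Qk g = μ → Sc f ≤ Sc g) → ρ f ≤ CR * (Sc f + qZ μ))
    (μ : Z) :
    blockSpin Qk Sc μ ≤ blockSpin (Qk ∘ Q₁) Sf μ + (2 * δ * Real.sqrt (Λ * (CP * (Λ + 1))) + δ ^ 2 * (CP * (Λ + 1))) * qZ μ ∧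
      blockSpin (Qk ∘ Q₁) Sf μ ≤ blockSpin Qk Sc μ
        + (ε₁ * CR * (Λ + 1) + 2 * δ' * Real.sqrt ((Λ + ε₁ * CR * (Λ + 1)) * (CP * (Λ + 1))) + δ' ^ 2 * (CP * (Λ + 1))) * qZ μ := by
  -- the coarse minimiser (P⁺ coercivity + UB⁺ nonemptiness)
  obtain ⟨fU, hfU, hfUb⟩ := hUBc μ
  obtain ⟨f₀, hf₀, hmin⟩ := exists_isMinOn_fib (qZ := qZ) hQk hSc hκ hCP hnormW hPc hfU
  -- the fine minimiser for the composite constraint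
  obtain ⟨gU, hgU, hgUb⟩ := hUBf μ
  have hPf' : ∀ f', qV f' ≤ CP * (Sf f' + qZ ((Qk ∘ Q₁) f')) := fun f' => by simpa using hPf f'
  obtain ⟨g₀, hg₀, hmin'⟩ := exists_isMinOn_fib (Q := Qk ∘ Q₁) (qZ := qZ) (hQk.comp hQ₁) hSf hκ hCP hnormV hPf'
    (f₁ := gU) (by simpa using hgU)
  have hg₀' : Qk (Q₁ g₀) = μ := by simpa using hg₀
  have hminf : ∀ f', Qk (Q₁ f') = μ → Sf g₀ ≤ Sf f' := fun f' hf' => hmin' f' (by simpa using hf')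
  -- sizes of the two minimisers
  have hSf_le : Sf g₀ ≤ Λ * qZ μ := (hminf gU hgU).trans hgUb
  have hSc_le : Sc f₀ ≤ Λ * qZ μ := (hmin fU hfU).trans hfUb
  have hqV_le : qV g₀ ≤ CP * (Λ + 1) * qZ μ := by
    calc qV g₀ ≤ CP * (Sf g₀ + qZ (Qk (Q₁ g₀))) := hPf g₀
      _ ≤ CP * (Λ * qZ μ + qZ μ) := by rw [hg₀']; gcongr
      _ = CP * (Λ + 1) * qZ μ := by ring
  have hqW_le : qW f₀ ≤ CP * (Λ + 1) * qZ μ := by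
    calc qW f₀ ≤ CP * (Sc f₀ + qZ (Qk f₀)) := hPc f₀
      _ ≤ CP * (Λ * qZ μ + qZ μ) := by rw [hf₀]; gcongr
      _ = CP * (Λ + 1) * qZ μ := by ring
  have hρ_le : ρ f₀ ≤ CR * (Λ + 1) * qZ μ := by
    calc ρ f₀ ≤ CR * (Sc f₀ + qZ μ) := hREG μ f₀ hf₀ hmin
      _ ≤ CR * (Λ * qZ μ + qZ μ) := by gcongr
      _ = CR * (Λ + 1) * qZ μ := by ring
  -- FED⁺ at the fine minimiser: additive defect e·qZ μ
  have hF : Sc (Q₁ g₀) ≤ Sf g₀ + (2 * δ * Real.sqrt (Λ * (CP * (Λ + 1))) + δ ^ 2 * (CP * (Λ + 1))) * qZ μ := by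
    have h := hFED g₀
    have hdef := defect_bound (s := Sf g₀) (v := qV g₀) (z := qZ μ) (P := CP * (Λ + 1)) hδ hΛ (by positivity) (hqZ0 μ)
      hSf_le hqV_le
    rw [add_sq, Real.sq_sqrt (hSf0 g₀), mul_pow, Real.sq_sqrt (hqV0 g₀)] at h
    linarith
  -- ONE⁺ at the coarse minimiser: the square-root shape becomes an additive defect e′·qZ μ
  have hc : blockSpin Q₁ Sf f₀ ≤ Sc f₀
      + (ε₁ * CR * (Λ + 1) + 2 * δ' * Real.sqrt ((Λ + ε₁ * CR * (Λ + 1)) * (CP * (Λ + 1))) + δ' ^ 2 * (CP * (Λ + 1))) * qZ μ := by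
    have h := hONE f₀
    have hs0 : 0 ≤ Sc f₀ + ε₁ * ρ f₀ := add_nonneg (hSc0 f₀) (mul_nonneg hε₁ (hρ0 f₀))
    have hs : Sc f₀ + ε₁ * ρ f₀ ≤ (Λ + ε₁ * CR * (Λ + 1)) * qZ μ := by
      nlinarith [hSc_le, mul_le_mul_of_nonneg_left hρ_le hε₁]
    have hΛ' : 0 ≤ Λ + ε₁ * CR * (Λ + 1) := by positivity
    have hdef := defect_bound (s := Sc f₀ + ε₁ * ρ f₀) (v := qW f₀) (z := qZ μ) (Λ := Λ + ε₁ * CR * (Λ + 1)) (P := CP * (Λ + 1))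
      hδ' hΛ' (by positivity) (hqZ0 μ) hs hqW_le
    rw [add_sq, Real.sq_sqrt hs0, mul_pow, Real.sq_sqrt (hqW0 f₀)] at h
    have hρ' : ε₁ * ρ f₀ ≤ ε₁ * CR * (Λ + 1) * qZ μ := by nlinarith [mul_le_mul_of_nonneg_left hρ_le hε₁]
    linarith
  exact step_additive hsurj hSc0 hSf0 hf₀ hmin hg₀' hminf hF hc

end Pair

/-! ## §2 The charged-scalar canonical pair (the capstone's letters) with ONE⁺ in the square-root shape -/

section Scalar

variable (n L : ℕ) [NeZero n] [NeZero L] (M : Fin d → ℕ) [hM : ∀ μ, NeZero (M μ)]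

/-- **THE ADDITIVE BRACKET FOR KING'S CHARGED SCALAR, CANONICAL PAIR, ONE⁺ IN THE HONEST SHAPE**: exactly
`VariationalCovariantScalarPair.scalar_pair_bracket` (FED⁺ and P⁺ discharged inside, UB⁺/REG⁺ hypotheses, global small-field frame data) with
`hONE′ : ∀ f, T_{Q₁}Sf (f) ≤ (√(Sc f + ε₁ρ f) + δ′√(qW f))²` — the shape supplied by `VariationalCovariantOneStepPhys.blockSpin_Q1_le` with
`ε₁ = (d/4 + 1/2)·L·n⁻²`, `δ′ = √(2d(1+d²))·n·L·m₁` (`m₁` = the one-step transport defects); `e′` as in `pair_bracket_sqrt` with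
`C_P = 1088d + 128`. [folklore] -/
theorem scalar_pair_bracket_sqrt {Rc : Tor (fine n M) → Fin d → ℂ} {R' : Tor (fine L (fine n M)) → Fin d → ℂ}
    {T G : Tor (fine n M) → ℂ} {T' G' : Tor (fine L (fine n M)) → ℂ} {c : Tor M → ℂ} {c' : Tor (fine n M) → ℂ}
    (hG : ∀ x, ‖G x‖ = 1) (hc : ∀ z, ‖c z‖ ≤ 1) {mG mB : ℝ}
    (hframe : ∀ x μ, ‖G (x + unitVec (fine n M) μ) - G x * Rc x μ‖ ≤ mG)
    (hblock : ∀ z j, ‖G (bpt n M z j) - c z * T (bpt n M z j)‖ ≤ mB)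
    (hsmall : 16 * (d : ℝ) ^ 2 * ((n : ℝ) * mG) ^ 2 + 4 * mB ^ 2 ≤ 1 / 2)
    (hG' : ∀ x, ‖G' x‖ = 1) (hc' : ∀ y, ‖c' y‖ ≤ 1) {mG' mB' : ℝ}
    (hframe' : ∀ x μ, ‖G' (x + unitVec (fine L (fine n M)) μ) - G' x * R' x μ‖ ≤ mG')
    (hblock' : ∀ y j, ‖G' (bpt L (fine n M) y j) - c' y * T' (bpt L (fine n M) y j)‖ ≤ mB')
    (hsmall' : 16 * (d : ℝ) ^ 2 * ((L : ℝ) * mG') ^ 2 + 4 * mB' ^ 2 ≤ 1 / 2)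
    (hR' : ∀ x μ, ‖R' x μ‖ ≤ 1) (hT' : ∀ x, ‖T' x‖ ≤ 1) (hT1 : ∀ x, ‖T' x‖ = 1) {m : ℝ} (hm : 0 ≤ m)
    (hmis : ∀ y μ j, ‖mis L (fine n M) Rc R' T' y μ j‖ ≤ m) (habsorb : 512 * (d : ℝ) ^ 2 * ((n : ℝ) * m) ^ 2 ≤ 1 / 2)
    {Λ CR ε₁ δ' : ℝ} (hΛ : 0 ≤ Λ) (hCR : 0 ≤ CR) (hε₁ : 0 ≤ ε₁) (hδ' : 0 ≤ δ') {ρ : (Tor (fine n M) → ℂ) → ℝ} (hρ0 : ∀ f, 0 ≤ ρ f)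
    -- leaf UB⁺ at both levels
    (hUBc : ∀ μ : Tor M → ℂ, ∃ f, Qk n M T f = μ ∧ Sc n M Rc f ≤ Λ * nsq μ)
    (hUBf : ∀ μ : Tor M → ℂ, ∃ f', Qk n M T (Q1 n L M T' f') = μ ∧ Sf n L M R' f' ≤ Λ * nsq μ)
    -- leaf ONE⁺ in the honest covariant shape, leaf REG⁺
    (hONE : ∀ f, blockSpin (Q1 n L M T') (Sf n L M R') f ≤ (Real.sqrt (Sc n M Rc f + ε₁ * ρ f) + δ' * Real.sqrt (qW n M f)) ^ 2)
    (hREG : ∀ (μ : Tor M → ℂ) f, Qk n M T f = μ → (∀ g, Qk n M T g = μ → Sc n M Rc f ≤ Sc n M Rc g) →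
      ρ f ≤ CR * (Sc n M Rc f + nsq μ))
    (μ : Tor M → ℂ) :
    blockSpin (Qk n M T) (Sc n M Rc) μ ≤ blockSpin (Qk n M T ∘ Q1 n L M T') (Sf n L M R') μ
        + (2 * (Real.sqrt d * ((n : ℝ) * m)) * Real.sqrt (Λ * ((1088 * d + 128) * (Λ + 1)))
            + (Real.sqrt d * ((n : ℝ) * m)) ^ 2 * ((1088 * d + 128) * (Λ + 1))) * nsq μ ∧
      blockSpin (Qk n M T ∘ Q1 n L M T') (Sf n L M R') μ ≤ blockSpin (Qk n M T) (Sc n M Rc) μ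
        + (ε₁ * CR * (Λ + 1) + 2 * δ' * Real.sqrt ((Λ + ε₁ * CR * (Λ + 1)) * ((1088 * d + 128) * (Λ + 1)))
            + δ' ^ 2 * ((1088 * d + 128) * (Λ + 1))) * nsq μ := by
  have hL1 : (1 : ℝ) ≤ L := by exact_mod_cast Nat.one_le_iff_ne_zero.mpr (NeZero.ne L)
  have hnLd : (0 : ℝ) ≤ ((n : ℝ) * L) ^ d := by positivity
  have hCP : (0 : ℝ) ≤ 1088 * d + 128 := by positivity
  have hδ : 0 ≤ Real.sqrt d * ((n : ℝ) * m) := by positivity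
  have hnormW : ∀ f : Tor (fine n M) → ℂ, ‖f‖ ^ 2 ≤ ((n : ℝ) * L) ^ d * qW n M f := by
    intro f
    refine (norm_sq_le_qW n M f).trans (mul_le_mul_of_nonneg_right ?_ (qW_nonneg n M f))
    rw [mul_pow]
    exact le_mul_of_one_le_right (by positivity) (one_le_pow₀ hL1)
  have hnormV : ∀ f' : Tor (fine L (fine n M)) → ℂ, ‖f'‖ ^ 2 ≤ ((n : ℝ) * L) ^ d * qV n L M f' := norm_sq_le_qV n L M
  refine pair_bracket_sqrt (V := Tor (fine L (fine n M)) → ℂ) (W := Tor (fine n M) → ℂ) (Z := Tor M → ℂ)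
    (Qk := Qk n M T) (Q₁ := Q1 n L M T') (Sc := Sc n M Rc) (Sf := Sf n L M R') (qW := qW n M) (qV := qV n L M) (qZ := nsq) (ρ := ρ)
    (continuous_Qc T) (continuous_Qc T') ?_ ?_ (Q1_surjective n L M T' hT1)
    (Sc_nonneg n M Rc) (Sf_nonneg n L M R') (qV_nonneg n L M) (qW_nonneg n M) (fun μ => nsq_nonneg μ) hρ0
    hnLd hΛ hCP hCR hδ hε₁ hδ' hnormW hnormV hUBc hUBf ?_ ?_ ?_ hONE hREG μ
  · exact continuous_sum_dirU Rc _
  · exact continuous_sum_dirU R' _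
  · intro f
    exact qW_le_coarse n M hG hc hframe hblock hsmall f
  · intro f'
    exact qV_le_composite n L M hG hc hframe hblock hsmall hG' hc' hframe' hblock' hsmall' hR' hT' hm hmis habsorb f'
  · intro f'
    exact Sc_Q1_le n L M hR' hT' hm hmis f'

end Scalar

end Summit.QuantumFields.BalabanUV.T4Continuum.VariationalCovariantAssemblySqrt

end
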